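import Literature.Topology.FourManifolds.DavisHyperbolicFourManifold
import Literature.Topology.FourManifolds.ClosedHyperbolicQuotient
import Literature.Geometry.Riemannian.Simplex5335Frame
import Literature.Geometry.Riemannian.HyperboloidDiscreteAction
import HarnessLib

/-!
# Davis 1985: a closed hyperbolic 4-manifold exists — proof

Discharge of `Davis1985_exists_closed_hyperbolic_four` (`DavisHyperbolicFourManifold.lean`) from the
tree's pieces: `Hyperboloid.exists_lattice_four` (`Simplex5335Frame.lean`: a torsion-free subgroup
`Γ ≤ O⁺(ℝ⁴ ⊕ ℝ)` of finite index in the `[5,3,3,5]` reflection group, with finitely many returns and a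
compact set meeting every orbit — Davis's `K ◁ [5,3,3,5]` replaced by a level-`3` congruence
subgroup), the transports of `HyperboloidDiscreteAction.lean` (finitely many returns ⇒ properly
discontinuous; torsion-free ⇒ free; the `C^∞` isometric action on `⊤ : Opens ℝ⁴` with
`Hyperboloid.metric ⊤`), and the quotient-manifold assembly
`exists_closed_hyperbolic_four_of_cocompact_action_hyperboloid` (`ClosedHyperbolicQuotient.lean`).

## References

* M. W. Davis, *A hyperbolic 4-manifold*, Proc. Amer. Math. Soc. 93 (1985) 325–328, §3 (p. 327). [`Davis1985`]
-/

noncomputable section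

open scoped Manifold ContDiff
open TopologicalSpace

namespace Literature.Topology.FourManifolds

open Literature.Geometry.Riemannian Literature.Geometry.Riemannian.Hyperboloid

/-- **Davis 1985: there is a closed hyperbolic 4-manifold** (`M⁴ = H⁴/K`, "`K` is torsion-free.
Consequently, `K` acts freely on `H⁴`, and `M⁴` is a hyperbolic 4-manifold", compact since `K` has
finite index in the cocompact reflection group of the 120-cell tessellation). [cite: Davis1985, §3 (p. 327)] -/
theorem Davis1985_exists_closed_hyperbolic_four_holds : Davis1985_exists_closed_hyperbolic_four := by
  obtain ⟨Γ, hret, htf, K, hK, hcov⟩ := exists_lattice_four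
  haveI hpd : ProperlyDiscontinuousSMul Γ (⊤ : Opens (EuclideanSpace ℝ (Fin 4))) :=
    properlyDiscontinuousSMul_top (properlyDiscontinuousSMul_of_finitelyManyReturns hret)
  haveI hfree : IsCancelSMul Γ (⊤ : Opens (EuclideanSpace ℝ (Fin 4))) :=
    isCancelSMul_top (isCancelSMul_of_finitelyManyReturns hret htf)
  exact exists_closed_hyperbolic_four_of_cocompact_action_hyperboloid (Γ := Γ)
    (fun γ ↦ contMDiff_topSmul_subgroup γ) (fun γ y v w ↦ metric_val_topSmul_subgroup γ y v w)
    (exists_isCompact_of_fundamentalDomain hK hcov)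

end Literature.Topology.FourManifolds
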